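import Summits.QuantumFields.QCD.Theses.NestedDissectionSea
import Summits.QuantumFields.QCD.Theorems.CoerciveSea.Negative.CellDeterminants

/-!
# Route `NestedDissectionSea`, support item `ChiralityPairing` (stmt-QuantumFields-13994)

If `0` is a simple eigenvalue (root multiplicity `1` of the characteristic polynomial at `0`) of a
Dirichlet Wilson cell `D_c = wilsonCell U μ' x s` and `w ≠ 0` is a kernel vector, then the chiral
pairing `⟨w, γ₅ w⟩ = Σ_p conj(w_p) (γ₅)_{α_p α_p} w_p` is non-zero.

Proof (linear algebra, Montvay–Münster (5.15) + Fitting's lemma).  γ₅-hermiticity restricts to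
principal submatrices because `Γ₅ = spinorLift γ₅` is diagonal: entrywise
`conj (D_c)_{ji} = χ_i (D_c)_{ij} χ_j` with `χ = (1, 1, −1, −1)` read off the spin index
(`CoerciveSeaNegative.conj_wilsonDirac_apply`).  Hence `u := χ • w` is a LEFT null vector,
`u† D_c = 0`, so `u ⊥ range D_c`.  If `⟨w, γ₅ w⟩ = ⟨u, w⟩ = 0` as well, then `u` is orthogonal to
`range D_c + span w`.  By Fitting's decomposition (`LinearMap.isCompl_iSup_ker_pow_iInf_range_pow`)
`ℂⁿ = ⋃ₖ ker D_cᵏ ⊕ ⋂ₖ range D_cᵏ`, and the generalised kernel has dimension equal to the root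
multiplicity of `0` in the characteristic polynomial (`LinearMap.finrank_maxGenEigenspace_eq`,
`Matrix.charpoly_toLin'`), here `1`, so it is `span w`; therefore `range D_c + span w = ℂⁿ`,
`u = 0`, `w = 0` — contradiction.  Meaning: `|⟨w, γ₅ w⟩| / ‖w‖² = 1/κ(0)`, the inverse eigenvalue
condition number of the crossing (the chirality of a real Wilson mode measures its robustness).
-/

namespace Summit.QuantumFields.QCD.Theorems

open Literature.MathematicalPhysics.QuantumLattice Literature.MathematicalPhysics.QuantumFieldTheory
  Literature.Probability.LatticeModels Matrix

/-- **Left/right pairing of a simple eigenvalue of a `χ`-hermitian matrix.**  Let `D` be a complex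
square matrix which is hermitian up to conjugation by a diagonal sign matrix `χ` (`χ_i² = 1`,
`χ_i` real): `conj D_{ji} = χ_i D_{ij} χ_j`.  If `w ≠ 0` is a right null vector and `0` has root
multiplicity `1` in the characteristic polynomial of `D`, then `Σ_p conj(w_p) χ_p w_p ≠ 0`: the left
null vector `χ • w` cannot be orthogonal to the right null vector (Fitting decomposition: the
generalised kernel is `span w` and complements `range D`). [folklore] -/
theorem star_chi_dotProduct_ne_zero_of_rootMultiplicity_eq_one {n : Type*} [Fintype n]
    [DecidableEq n] (D : Matrix n n ℂ) (χ : n → ℂ) (hχ2 : ∀ i, χ i * χ i = 1)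
    (hχs : ∀ i, star (χ i) = χ i) (hD : ∀ i j, star (D j i) = χ i * D i j * χ j)
    (w : n → ℂ) (hw : w ≠ 0) (hDw : D *ᵥ w = 0) (hmult : D.charpoly.rootMultiplicity 0 = 1) :
    (∑ p, star (w p) * χ p * w p) ≠ 0 := by
  intro h0
  -- the left null vector `u = χ • w`
  set u : n → ℂ := fun p => χ p * w p with hu_def
  have hu : star u ᵥ* D = 0 := by
    funext q
    have hq : (∑ p, D q p * w p) = 0 := by
      have := congrFun hDw q
      change (∑ p, D q p * w p) = 0 at this
      exact this
    change (∑ p, star (χ p * w p) * D p q) = 0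
    have hterm : ∀ p, star (χ p * w p) * D p q = χ q * star (D q p * w p) := fun p => by
      rw [star_mul', star_mul', hχs, hD p q]
      linear_combination (-(χ p * D p q * star (w p))) * hχ2 q
    simp_rw [hterm]
    rw [← Finset.mul_sum, ← star_sum, hq, star_zero, mul_zero]
  -- `u ⊥ range D`
  have hrange : ∀ v, star u ⬝ᵥ (D *ᵥ v) = 0 := fun v => by
    rw [Matrix.dotProduct_mulVec, hu, zero_dotProduct]
  -- `u ⊥ w` (the hypothesis to be contradicted)
  have hw' : star u ⬝ᵥ w = 0 := by
    have : star u ⬝ᵥ w = ∑ p, star (w p) * χ p * w p := by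
      change (∑ p, star (χ p * w p) * w p) = ∑ p, star (w p) * χ p * w p
      refine Finset.sum_congr rfl fun p _ => ?_
      rw [star_mul', hχs, mul_comm (χ p)]
    rw [this, h0]
  -- Fitting: `range D + span w = ⊤`, hence `u ⊥` everything
  have hall : ∀ v, star u ⬝ᵥ v = 0 := by
    intro v
    set φ : Module.End ℂ (n → ℂ) := Matrix.toLin' D with hφ_def
    have hφ : ∀ y, φ y = D *ᵥ y := fun y => Matrix.toLin'_apply D y
    have hfin : Module.finrank ℂ (Module.End.maxGenEigenspace φ 0) = 1 := by
      rw [LinearMap.finrank_maxGenEigenspace_eq, hφ_def, Matrix.charpoly_toLin', hmult]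
    have hwV : w ∈ Module.End.maxGenEigenspace φ 0 := by
      rw [Module.End.mem_maxGenEigenspace]
      exact ⟨1, by rw [zero_smul, sub_zero, pow_one, hφ, hDw]⟩
    have hspan : ∀ a ∈ Module.End.maxGenEigenspace φ 0, ∃ c : ℂ, c • w = a := by
      intro a ha
      have hw0 : (⟨w, hwV⟩ : Module.End.maxGenEigenspace φ 0) ≠ 0 := by
        intro h
        exact hw (congrArg Subtype.val h)
      obtain ⟨c, hc⟩ :=
        (finrank_eq_one_iff_of_nonzero' (⟨w, hwV⟩ : Module.End.maxGenEigenspace φ 0) hw0).1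
          hfin ⟨a, ha⟩
      exact ⟨c, congrArg Subtype.val hc⟩
    have hle : (⨆ k : ℕ, LinearMap.ker (φ ^ k)) ≤ Module.End.maxGenEigenspace φ 0 :=
      iSup_le fun k x hx =>
        (Module.End.mem_maxGenEigenspace φ 0 x).2 ⟨k, by rwa [zero_smul, sub_zero]⟩
    have hc : IsCompl (⨆ k : ℕ, LinearMap.ker (φ ^ k)) (⨅ k : ℕ, LinearMap.range (φ ^ k)) :=
      LinearMap.isCompl_iSup_ker_pow_iInf_range_pow φ
    have hv : v ∈ (⨆ k : ℕ, LinearMap.ker (φ ^ k)) ⊔ (⨅ k : ℕ, LinearMap.range (φ ^ k)) := by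
      rw [hc.sup_eq_top]
      exact Submodule.mem_top
    obtain ⟨a, ha, b, hb, rfl⟩ := Submodule.mem_sup.1 hv
    obtain ⟨c, rfl⟩ := hspan a (hle ha)
    have hb1 : b ∈ LinearMap.range (φ ^ 1) := (Submodule.mem_iInf _).1 hb 1
    rw [pow_one] at hb1
    obtain ⟨y, rfl⟩ := LinearMap.mem_range.1 hb1
    rw [dotProduct_add, dotProduct_smul, hw', smul_zero, zero_add, hφ, hrange]
  have hu0 : star u = 0 := dotProduct_eq_zero _ hall
  have hu0' : u = 0 := star_eq_zero.1 hu0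
  apply hw
  funext p
  have hp : χ p * w p = 0 := congrFun hu0' p
  rcases mul_eq_zero.1 hp with h | h
  · exact absurd (hχ2 p) (by rw [h, zero_mul]; exact zero_ne_one)
  · exact h

/-- The chirality signs `(1, 1, −1, −1)` are real: `conj χ_k = χ_k`. [folklore] -/
theorem star_chiSign (k : Fin 4) :
    star ((![1, 1, -1, -1] : Fin 4 → ℂ) k) = (![1, 1, -1, -1] : Fin 4 → ℂ) k := by
  fin_cases k <;> simp

/-- **Route item `ChiralityPairing`** (stmt-QuantumFields-13994): for every torus side `N`, every
`SU(3)` lattice gauge field `U`, bare mass `μ'`, box `(x, s)` and every non-zero kernel vector `w`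
of the Dirichlet Wilson cell `wilsonCell U μ' x s` whose eigenvalue `0` is simple (root multiplicity
`1` of the characteristic polynomial), the chiral pairing `Σ_p conj(w_p) (γ₅)_{α_p α_p} w_p` is
non-zero.  γ₅-hermiticity entrywise (`CoerciveSeaNegative.conj_wilsonDirac_apply`, from
`wilsonDirac_gammaFive_hermitian_holds`) feeds
`star_chi_dotProduct_ne_zero_of_rootMultiplicity_eq_one`; `γ₅ = diag(1, 1, −1, −1)`
(`gammaFive_eq_diagonal`). -/
theorem chiralityPairing_proof :
    Summit.QuantumFields.QCD.Theses.NestedDissectionSea.ChiralityPairing := by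
  unfold Summit.QuantumFields.QCD.Theses.NestedDissectionSea.ChiralityPairing
  intro N _ U μ' x s w hw hDw hmult
  have hγ : ∀ p : {p // wilsonBox x s p},
      gammaFive p.1.2.2 p.1.2.2 = (![1, 1, -1, -1] : Fin 4 → ℂ) p.1.2.2 := fun p => by
    rw [gammaFive_eq_diagonal, Matrix.diagonal_apply_eq]
  simp_rw [hγ]
  exact star_chi_dotProduct_ne_zero_of_rootMultiplicity_eq_one (wilsonCell U μ' x s)
    (fun p => (![1, 1, -1, -1] : Fin 4 → ℂ) p.1.2.2) (fun p => CoerciveSeaNegative.chiSign_sq p.1.2.2)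
    (fun p => star_chiSign p.1.2.2)
    (fun i j => by
      rw [← starRingEnd_apply]
      exact CoerciveSeaNegative.conj_wilsonDirac_apply (fundamentalRep (Fin 3))
        fundamentalRep_mem_unitaryGroup U μ' i.1 j.1)
    w hw hDw hmult

end Summit.QuantumFields.QCD.Theorems
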